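import Mathlib

/-!
# Waldschmidt 1978, Theorem 4.7: a transcendence measure for `α^β`

M. Waldschmidt, *Transcendence measures for exponentials and logarithms*, J. Austral. Math. Soc. Ser. A 25
(1978) 445–465 (doi:10.1017/S1446788700021431), Theorem 4.7 (p. 459; Fig. 1 type 4): for algebraic `α ≠ 0`
with `log α ≠ 0` (any determination) and algebraic irrational `β`, the number `α^β = exp(β log α)` has the
transcendence measure `C₂₄(β, log α) · N³ (Log H + Log N)(Log Log H + Log N)(1 + Log N)⁻²`.  NAMED FACT
(statement only, not proved here); users take `(h : Waldschmidt1978_thm_4_7)`.  Typed print-faithfully by the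
decomp-schanuel cell (lens-2 g43 «POWER TRANSPORT», critic VERDICT on the cell bus 2026-08-31: print-faithful,
weakenings only; provenance note: the printed Thm 4.7 combines Waldschmidt's own measure (24) with
Čudnovs'kiĭ's Thm 1.5); consumer: `Summits/Schanuel/Schanuel/Theorems/RootDecomp1ELevelTransport*` (the
`√2·log 2`-weighted radix class, `κ = 2^{√2}` of transcendence type 5).
-/

namespace Literature.NumberTheory.Transcendental

open Polynomial Complex

/-- **Waldschmidt 1978, Theorem 4.7 (p. 459) — NAMED FACT, typed print-faithfully.**  PRINTED (p. 459, read
2026-08-31): "THEOREM 4.7. There exists a positive real number `C₂₄(β, log α)` such that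
`C₂₄(β, log α) N³ (Log H + Log N)(Log Log H + Log N)(1 + Log N)⁻²` is a transcendence measure for `α^β`."
CONVENTIONS (p. 445–446): `φ(X, Y)` defined for `X ≥ 1`, `Y ≥ log 16`; "`φ` is a transcendence measure for `ω` if
`log |P(ω)| ≥ −φ(N, log H)` for all non-trivial polynomials `P ∈ ℤ[X]` with degree at most `N` and height (in the
usual sense) at most `H`"; "for real `x`, we write `Log x = log max(1, x)`"; hypotheses of §4.3 (p. 458): `α, β`
algebraic, `α ≠ 0`, `log α ≠ 0` (any determination), `β` irrational, `α^β := exp(β log α)`.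
TYPED: with `ℓ := log α` (so `ℓ ≠ 0`, `e^ℓ = α` algebraic), `β` algebraic with `β ∉ ℚ`, for `N ≥ 1`, `H ≥ 16`:
`|P(e^{βℓ})| ≥ exp(−C N³ (log H + log N)(log log H + log N)/(1 + log N)²)`.  On this range `Log N = log N`,
`Log H = log H`, `Log Log H = log log H` (`log H ≥ log 16 > 1`), so this is the printed inequality; should `Log` be
read as `max(1, log ·)` instead, the typed bound is still IMPLIED by the printed one (the displayed function is
decreasing in `Log N ≥ log N` because `log H, log log H ≥ 1`) — weakenings only.  The printed positive constant is
rendered existentially.  [M. Waldschmidt, *Transcendence measures for exponentials and logarithms*, J. Austral.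
Math. Soc. Ser. A 25 (1978) 445–465, doi:10.1017/S1446788700021431, Thm 4.7; in-tree derivation: none
(`baker1975_thm_3_1` is degree-opaque, `CijsouwWaldschmidt1977Main` is over `ℚ`).]
NAMED FACT, not proved here; users take `(h : Waldschmidt1978_thm_4_7)`.
[cite: Waldschmidt1978, Thm 4.7] -/
def Waldschmidt1978_thm_4_7 : Prop :=
  ∀ ℓ β : ℂ, ℓ ≠ 0 → IsAlgebraic ℚ (cexp ℓ) → IsAlgebraic ℚ β → β ∉ Set.range (algebraMap ℚ ℂ) →
    ∃ C : ℝ, 0 < C ∧ ∀ (P : ℤ[X]) (N H : ℕ), P ≠ 0 → 1 ≤ N → P.natDegree ≤ N → 16 ≤ H →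
      (∀ k, |P.coeff k| ≤ (H : ℤ)) →
      Real.exp (-(C * (N : ℝ) ^ 3 * (Real.log H + Real.log N) * (Real.log (Real.log H) + Real.log N) /
          (1 + Real.log N) ^ 2)) ≤ ‖aeval (cexp (β * ℓ)) P‖

end Literature.NumberTheory.Transcendental
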